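import Mathlib

/-!
# Second-order expansion against concentrated measures (analysis toolkit of line `crossing-martingale`, crux `CardyRigidity`)

Pure real analysis, Mathlib only; first of the `KernelODE` files of stub `stub_kernelAffineBeta`
(crux `CardyRigidity`, stmt-CriticalPhenomena-0746, line `crossing-martingale`).  The probabilistic
half of the line turns the crossing-martingale property of a continuous kernel `f` into EXACT
mean-value identities `f η = ∫ f (η + x) dν_n(x)` at every modulus `η`, where `ν_n` (the law of the
increment of the level-stopped modulus at mark scale `n`) is carried by `[-r_n, r_n]`, `r_n → 0`,
with first and second moments `a/n² + o(n⁻²)`, `b/n² + o(n⁻²)` (the "asymptotic mean-value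
property", spelled out inline in the consumer's hypotheses; no definitions are introduced).  This file
supplies the calculus used to exploit such identities: a second-order Taylor bound
with a continuity-modulus remainder (`taylor_two_bound`, two mean-value inequalities, no `C³`),
integrability of continuous functions against a finite measure carried by a small interval, and the
expansion `∫ u (η + x) dν = u η + u' η ∫x + (u'' η/2) ∫x² + O(ω ∫x²)` with its main term isolated
against the moment asymptotics (`abs_integral_shift_sub_main_le`).  Consumer: the maximum principle
`KernelODE.sub_le_max_of_mvp` (file `…KernelODEMaxPrinciple`).
-/

noncomputable section

open MeasureTheory Filter Set Topology
open scoped BigOperators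

namespace Summit.CriticalPhenomena.CardyFormulaZ2.Cruxes.CardyRigidity.CrossingMartingale

namespace KernelODE

/-! ### Second-order Taylor bound with a continuity-modulus remainder -/

/-- If `u' = u₁`, `u₁' = u₂` on `[η - ρ, η + ρ]` and `|u₂ (η + x) - u₂ η| ≤ ω` for `|x| ≤ ρ`, then
`|u (η + x) - u η - u₁ η x - u₂ η x² / 2| ≤ ω x²` for `|x| ≤ ρ`. [folklore] -/
theorem taylor_two_bound {u u₁ u₂ : ℝ → ℝ} {η ρ ω : ℝ} (hω : 0 ≤ ω)
    (hu : ∀ y ∈ Icc (η - ρ) (η + ρ), HasDerivAt u (u₁ y) y)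
    (hu₁ : ∀ y ∈ Icc (η - ρ) (η + ρ), HasDerivAt u₁ (u₂ y) y)
    (hmod : ∀ x ∈ Icc (-ρ) ρ, |u₂ (η + x) - u₂ η| ≤ ω) {x : ℝ} (hx : x ∈ Icc (-ρ) ρ) :
    |u (η + x) - u η - u₁ η * x - u₂ η * x ^ 2 / 2| ≤ ω * x ^ 2 := by
  -- the remainder `φ` and its derivative `φ'`
  set φ : ℝ → ℝ := fun y ↦ u (η + y) - u η - u₁ η * y - u₂ η * y ^ 2 / 2 with hφ
  set φ' : ℝ → ℝ := fun y ↦ u₁ (η + y) - u₁ η - u₂ η * y with hφ'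
  have hmem : ∀ y ∈ Icc (-ρ) ρ, η + y ∈ Icc (η - ρ) (η + ρ) := fun y hy ↦
    ⟨by linarith [hy.1], by linarith [hy.2]⟩
  have hφd : ∀ y ∈ Icc (-ρ) ρ, HasDerivAt φ (φ' y) y := by
    intro y hy
    have h1 : HasDerivAt (fun y ↦ u (η + y)) (u₁ (η + y)) y :=
      HasDerivAt.comp_const_add η y (hu (η + y) (hmem y hy))
    have h2 : HasDerivAt (fun y : ℝ ↦ u₁ η * y) (u₁ η * 1) y := (hasDerivAt_id y).const_mul (u₁ η)
    have h3 : HasDerivAt (fun y : ℝ ↦ u₂ η * y ^ 2 / 2) (u₂ η * (↑2 * y ^ (2 - 1)) / 2) y :=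
      ((hasDerivAt_pow 2 y).const_mul (u₂ η)).div_const 2
    have key : HasDerivAt (fun y ↦ u (η + y) - u η - u₁ η * y - u₂ η * y ^ 2 / 2)
        (u₁ (η + y) - u₁ η * 1 - u₂ η * (↑2 * y ^ (2 - 1)) / 2) y :=
      ((h1.sub_const (u η)).sub h2).sub h3
    refine key.congr_deriv ?_
    simp only [hφ']
    norm_num
    ring
  have hφ'd : ∀ y ∈ Icc (-ρ) ρ, HasDerivAt φ' (u₂ (η + y) - u₂ η) y := by
    intro y hy
    have h1 : HasDerivAt (fun y ↦ u₁ (η + y)) (u₂ (η + y)) y :=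
      HasDerivAt.comp_const_add η y (hu₁ (η + y) (hmem y hy))
    have h2 : HasDerivAt (fun y : ℝ ↦ u₂ η * y) (u₂ η * 1) y := (hasDerivAt_id y).const_mul (u₂ η)
    have key : HasDerivAt (fun y ↦ u₁ (η + y) - u₁ η - u₂ η * y) (u₂ (η + y) - u₂ η * 1) y :=
      (h1.sub_const (u₁ η)).sub h2
    refine key.congr_deriv ?_
    ring
  have hφ0 : φ 0 = 0 := by simp [hφ]
  have hφ'0 : φ' 0 = 0 := by simp [hφ']
  -- first: `|φ' y| ≤ ω |y|` on `[-ρ, ρ]`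
  have hρ : 0 ≤ ρ := by linarith [hx.1, hx.2]
  have key1 : ∀ y ∈ Icc (-ρ) ρ, |φ' y| ≤ ω * |y| := by
    intro y hy
    -- mean value inequality on the segment from `0` to `y`
    have hseg : ∀ z ∈ segment ℝ 0 y, z ∈ Icc (-ρ) ρ := by
      intro z hz
      rw [segment_eq_uIcc, mem_uIcc] at hz
      rcases hz with ⟨h1, h2⟩ | ⟨h1, h2⟩
      · exact ⟨by linarith [hy.1], by linarith [hy.2]⟩
      · exact ⟨by linarith [hy.1], by linarith [hy.2]⟩
    have hbound : ∀ z ∈ segment ℝ 0 y, ‖u₂ (η + z) - u₂ η‖ ≤ ω := fun z hz ↦ by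
      rw [Real.norm_eq_abs]; exact hmod z (hseg z hz)
    have := (convex_segment (0 : ℝ) y).norm_image_sub_le_of_norm_hasDerivWithin_le
      (f := φ') (f' := fun z ↦ u₂ (η + z) - u₂ η)
      (fun z hz ↦ (hφ'd z (hseg z hz)).hasDerivWithinAt) hbound
      (left_mem_segment ℝ 0 y) (right_mem_segment ℝ 0 y)
    rw [hφ'0, sub_zero, sub_zero, Real.norm_eq_abs, Real.norm_eq_abs] at this
    exact this
  -- second: `|φ x| ≤ ω x²`
  have hseg : ∀ z ∈ segment ℝ 0 x, z ∈ Icc (-ρ) ρ ∧ |z| ≤ |x| := by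
    intro z hz
    rw [segment_eq_uIcc, mem_uIcc] at hz
    rcases hz with ⟨h1, h2⟩ | ⟨h1, h2⟩
    · exact ⟨⟨by linarith [hx.1], by linarith [hx.2]⟩, by
        rw [abs_of_nonneg h1, abs_of_nonneg (h1.trans h2)]; exact h2⟩
    · exact ⟨⟨by linarith [hx.1], by linarith [hx.2]⟩, by
        rw [abs_of_nonpos h2, abs_of_nonpos (h1.trans h2)]; linarith⟩
  have hbound : ∀ z ∈ segment ℝ 0 x, ‖φ' z‖ ≤ ω * |x| := fun z hz ↦ by
    rw [Real.norm_eq_abs]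
    exact (key1 z (hseg z hz).1).trans (mul_le_mul_of_nonneg_left (hseg z hz).2 hω)
  have := (convex_segment (0 : ℝ) x).norm_image_sub_le_of_norm_hasDerivWithin_le
    (f := φ) (f' := φ') (fun z hz ↦ (hφd z (hseg z hz).1).hasDerivWithinAt) hbound
    (left_mem_segment ℝ 0 x) (right_mem_segment ℝ 0 x)
  rw [hφ0, sub_zero, sub_zero, Real.norm_eq_abs, Real.norm_eq_abs] at this
  calc |u (η + x) - u η - u₁ η * x - u₂ η * x ^ 2 / 2| = |φ x| := rfl
    _ ≤ ω * |x| * |x| := this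
    _ = ω * x ^ 2 := by rw [mul_assoc, ← sq, sq_abs]

/-! ### Integration against a probability measure concentrated on a small interval -/

section Concentrated

variable {ν : Measure ℝ} {r ρ η : ℝ}

/-- `ν (Icc (-r) r)ᶜ = 0` says that `ν`-a.e. point lies in `[-r, r]`. [folklore] -/
theorem ae_mem_Icc_of_compl_null (hsupp : ν (Icc (-r) r)ᶜ = 0) : ∀ᵐ x ∂ν, x ∈ Icc (-r) r :=
  mem_ae_iff.2 hsupp

/-- A function continuous on `[η - ρ, η + ρ]`, shifted by `η`, is `ν`-integrable when `ν` is a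
finite measure carried by `[-r, r] ⊆ [-ρ, ρ]`. [folklore] -/
theorem integrable_shift_of_continuousOn [IsFiniteMeasure ν] {φ : ℝ → ℝ}
    (hφ : ContinuousOn φ (Icc (η - ρ) (η + ρ))) (hr : r ≤ ρ) (hsupp : ν (Icc (-r) r)ᶜ = 0) :
    Integrable (fun x ↦ φ (η + x)) ν := by
  have haeρ : ∀ᵐ x ∂ν, x ∈ Icc (-ρ) ρ := by
    filter_upwards [ae_mem_Icc_of_compl_null hsupp] with x hx
    exact ⟨by linarith [hx.1], by linarith [hx.2]⟩
  have hcont : ContinuousOn (fun x ↦ φ (η + x)) (Icc (-ρ) ρ) := by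
    refine hφ.comp (continuous_const_add η).continuousOn ?_
    intro x hx
    exact ⟨by linarith [hx.1], by linarith [hx.2]⟩
  have hmeas : AEStronglyMeasurable (fun x ↦ φ (η + x)) ν := by
    rw [← Measure.restrict_eq_self_of_ae_mem haeρ]
    exact hcont.aestronglyMeasurable measurableSet_Icc
  obtain ⟨C, hC⟩ := isCompact_Icc.exists_bound_of_continuousOn hcont
  refine Integrable.mono' (integrable_const C) hmeas ?_
  filter_upwards [haeρ] with x hx
  exact hC x hx

/-- A continuous function of the variable is `ν`-integrable when `ν` is a finite measure carried
by `[-r, r]`. [folklore] -/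
theorem integrable_of_continuous_of_compl_null [IsFiniteMeasure ν] {φ : ℝ → ℝ}
    (hφ : Continuous φ) (hsupp : ν (Icc (-r) r)ᶜ = 0) : Integrable φ ν := by
  obtain ⟨C, hC⟩ := isCompact_Icc.exists_bound_of_continuousOn (hφ.continuousOn (s := Icc (-r) r))
  refine Integrable.mono' (integrable_const C) hφ.aestronglyMeasurable ?_
  filter_upwards [ae_mem_Icc_of_compl_null hsupp] with x hx
  exact hC x hx

/-- **Second-order expansion of `∫ u (η + x) dν`** for `ν` a probability measure carried by
`[-r, r]`, `r ≤ ρ`, when `u` is `C²` on `[η - ρ, η + ρ]` with `|u'' (η + x) - u'' η| ≤ ω` for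
`|x| ≤ ρ`: the remainder after `u η + u' η ∫ x + (u'' η / 2) ∫ x²` is at most `ω ∫ x²`. [folklore] -/
theorem abs_integral_shift_sub_le [IsProbabilityMeasure ν] {u u₁ u₂ : ℝ → ℝ} {ω : ℝ}
    (hω : 0 ≤ ω) (hu : ∀ y ∈ Icc (η - ρ) (η + ρ), HasDerivAt u (u₁ y) y)
    (hu₁ : ∀ y ∈ Icc (η - ρ) (η + ρ), HasDerivAt u₁ (u₂ y) y)
    (hmod : ∀ x ∈ Icc (-ρ) ρ, |u₂ (η + x) - u₂ η| ≤ ω) (hr : r ≤ ρ)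
    (hsupp : ν (Icc (-r) r)ᶜ = 0) :
    |∫ x, u (η + x) ∂ν - u η - u₁ η * ∫ x, x ∂ν - u₂ η / 2 * ∫ x, x ^ 2 ∂ν| ≤
      ω * ∫ x, x ^ 2 ∂ν := by
  have haeρ : ∀ᵐ x ∂ν, x ∈ Icc (-ρ) ρ := by
    filter_upwards [ae_mem_Icc_of_compl_null hsupp] with x hx
    exact ⟨by linarith [hx.1], by linarith [hx.2]⟩
  -- integrability of the pieces
  have hcontu : ContinuousOn u (Icc (η - ρ) (η + ρ)) := fun y hy ↦
    (hu y hy).continuousAt.continuousWithinAt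
  have hIu : Integrable (fun x ↦ u (η + x)) ν := integrable_shift_of_continuousOn hcontu hr hsupp
  have hI1 : Integrable (fun x : ℝ ↦ x) ν := integrable_of_continuous_of_compl_null continuous_id hsupp
  have hI2 : Integrable (fun x : ℝ ↦ x ^ 2) ν :=
    integrable_of_continuous_of_compl_null (continuous_pow 2) hsupp
  -- the remainder and its pointwise bound
  set R : ℝ → ℝ := fun x ↦ u (η + x) - u η - u₁ η * x - u₂ η * x ^ 2 / 2 with hR
  have hRbound : ∀ᵐ x ∂ν, ‖R x‖ ≤ ω * x ^ 2 := by
    filter_upwards [haeρ] with x hx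
    rw [Real.norm_eq_abs]
    exact taylor_two_bound hω hu hu₁ hmod hx
  have hIR : Integrable R ν := by
    have : R = fun x ↦ u (η + x) - u η - u₁ η * x - u₂ η * x ^ 2 / 2 := rfl
    rw [this]
    exact ((hIu.sub (integrable_const _)).sub (hI1.const_mul _)).sub
      ((hI2.const_mul _).div_const _)
  -- rewrite the integral
  have hsplit : ∫ x, u (η + x) ∂ν =
      u η + u₁ η * ∫ x, x ∂ν + u₂ η / 2 * ∫ x, x ^ 2 ∂ν + ∫ x, R x ∂ν := by
    have hfun : (fun x ↦ u (η + x)) =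
        fun x ↦ (u η + u₁ η * x + u₂ η / 2 * x ^ 2) + R x := by
      funext x; simp only [hR]; ring
    rw [hfun, integral_add _ hIR, integral_add _ ((hI2.const_mul _)), integral_add (integrable_const _)
      (hI1.const_mul _), integral_const, integral_const_mul, integral_const_mul]
    · simp
    · exact (integrable_const _).add (hI1.const_mul _)
    · exact ((integrable_const _).add (hI1.const_mul _)).add (hI2.const_mul _)
  have hkey : ∫ x, u (η + x) ∂ν - u η - u₁ η * ∫ x, x ∂ν - u₂ η / 2 * ∫ x, x ^ 2 ∂ν =
      ∫ x, R x ∂ν := by rw [hsplit]; ring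
  rw [hkey]
  calc |∫ x, R x ∂ν| ≤ ∫ x, ω * x ^ 2 ∂ν := by
        have := norm_integral_le_of_norm_le (hI2.const_mul ω) hRbound
        simpa [Real.norm_eq_abs] using this
    _ = ω * ∫ x, x ^ 2 ∂ν := integral_const_mul _ _

/-- **The main term of `∫ u (η + x) dν`**: with moment errors `|∫x - a/N|, |∫x² - b/N| ≤ e/N`,
the integral differs from `u η + (u' η a + u'' η b / 2)/N` by at most
`(|u' η| + |u'' η|/2) e/N + ω ∫ x²`. [folklore] -/
theorem abs_integral_shift_sub_main_le' [IsProbabilityMeasure ν] {u u₁ u₂ : ℝ → ℝ}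
    {ω a b e N : ℝ} (hω : 0 ≤ ω) (hu : ∀ y ∈ Icc (η - ρ) (η + ρ), HasDerivAt u (u₁ y) y)
    (hu₁ : ∀ y ∈ Icc (η - ρ) (η + ρ), HasDerivAt u₁ (u₂ y) y)
    (hmod : ∀ x ∈ Icc (-ρ) ρ, |u₂ (η + x) - u₂ η| ≤ ω) (hr : r ≤ ρ)
    (hsupp : ν (Icc (-r) r)ᶜ = 0) (hm₁ : |∫ x, x ∂ν - a / N| ≤ e / N)
    (hm₂ : |∫ x, x ^ 2 ∂ν - b / N| ≤ e / N) :
    |∫ x, u (η + x) ∂ν - u η - (u₁ η * a + u₂ η / 2 * b) / N| ≤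
      (|u₁ η| + |u₂ η| / 2) * (e / N) + ω * ∫ x, x ^ 2 ∂ν := by
  have h0 := abs_integral_shift_sub_le hω hu hu₁ hmod hr hsupp
  have h1 : |u₁ η * (∫ x, x ∂ν - a / N)| ≤ |u₁ η| * (e / N) := by
    rw [abs_mul]; exact mul_le_mul_of_nonneg_left hm₁ (abs_nonneg _)
  have h2 : |u₂ η / 2 * (∫ x, x ^ 2 ∂ν - b / N)| ≤ |u₂ η| / 2 * (e / N) := by
    rw [abs_mul, abs_div, abs_two]; exact mul_le_mul_of_nonneg_left hm₂ (by positivity)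
  have hsplit : ∫ x, u (η + x) ∂ν - u η - (u₁ η * a + u₂ η / 2 * b) / N =
      (∫ x, u (η + x) ∂ν - u η - u₁ η * ∫ x, x ∂ν - u₂ η / 2 * ∫ x, x ^ 2 ∂ν) +
      (u₁ η * (∫ x, x ∂ν - a / N) + u₂ η / 2 * (∫ x, x ^ 2 ∂ν - b / N)) := by ring
  rw [hsplit]
  calc _ ≤ |∫ x, u (η + x) ∂ν - u η - u₁ η * ∫ x, x ∂ν - u₂ η / 2 * ∫ x, x ^ 2 ∂ν| +
        |u₁ η * (∫ x, x ∂ν - a / N) + u₂ η / 2 * (∫ x, x ^ 2 ∂ν - b / N)| := abs_add_le _ _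
    _ ≤ ω * ∫ x, x ^ 2 ∂ν + (|u₁ η| * (e / N) + |u₂ η| / 2 * (e / N)) :=
        add_le_add h0 ((abs_add_le _ _).trans (add_le_add h1 h2))
    _ = (|u₁ η| + |u₂ η| / 2) * (e / N) + ω * ∫ x, x ^ 2 ∂ν := by ring

/-- **Registered form** (glue sub-goal `abs_integral_shift_sub_main_le` of stmt-CriticalPhenomena-0746):
the main-term second-order expansion of `∫ u (η + x) dν` against a probability measure carried by
`[-r, r]`, with the moment errors. [folklore] -/
theorem abs_integral_shift_sub_main_le : ∀ {ν : MeasureTheory.Measure ℝ} {r ρ η : ℝ} [MeasureTheory.IsProbabilityMeasure ν] {u u₁ u₂ : ℝ → ℝ} {ω a b e N : ℝ}, 0 ≤ ω → (∀ y ∈ Set.Icc (η - ρ) (η + ρ), HasDerivAt u (u₁ y) y) → (∀ y ∈ Set.Icc (η - ρ) (η + ρ), HasDerivAt u₁ (u₂ y) y) → (∀ x ∈ Set.Icc (-ρ) ρ, |u₂ (η + x) - u₂ η| ≤ ω) → r ≤ ρ → ν (Set.Icc (-r) r)ᶜ = 0 → |∫ x, x ∂ν - a / N| ≤ e / N → |∫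 x, x ^ 2 ∂ν - b / N| ≤ e / N → |∫ x, u (η + x) ∂ν - u η - (u₁ η * a + u₂ η / 2 * b) / N| ≤ (|u₁ η| + |u₂ η| / 2) * (e / N) + ω * ∫ x, x ^ 2 ∂ν :=
  fun hω hu hu₁ hmod hr hsupp hm₁ hm₂ ↦ abs_integral_shift_sub_main_le' hω hu hu₁ hmod hr hsupp hm₁ hm₂

end Concentrated

end KernelODE

end Summit.CriticalPhenomena.CardyFormulaZ2.Cruxes.CardyRigidity.CrossingMartingale

end
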